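/-
Copyright: the b2b-balaban T⁴-continuum CRUX team, row NE7b leaf lineage `t4-ne7b-formalise-leaf-05` (gen 153). Project licence.
-/
import Literature.MathematicalPhysics.QuantumFieldTheory.Balaban1983to89.B9SectEKernel

/-!
# THE IMS ERROR LETTER `ε` OF THE (h2) SKELETON FROM FOUR SUB-LETTERS: `Σ_j |K_F(i,j)|·Σ_s (h_s(i) − h_s(j))² ≤ ν·κ·μ·(ℓR)²` from the RANGE `R` and
# coefficient bound `κ` of `K_F` with `ν` neighbours per row, and cutoffs `h_s` that are `ℓ`-Lipschitz (`ℓ = c_h∕M`) with at most `μ` of them alive at any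
# pair of sites — so `ε = ε_IMS(M) = νκμc_h²R²∕M²` and `M² ≥ 4νκμc_h²R²∕c` gives `ε ≤ c∕4` (SectE-interface-proof Prop. 5.6's
# `ε_IMS ≤ C_F 2^d c_h²(L+1)²∕M²`, `M ≥ M₃(d,L)`); then `B9SectEKernel.ims_lower` BY NAME with its Schur letters SUPPLIED (row NE7b, node U5c;
# residual (R2′) family (2), letter (ℓ1); kernel lemmas + junction)

Cell `pub-balaban`, sub-cell `t4`, spine estimate NE7b (`T4WeightBudget.RelWeightBound`; the cell's OWN estimate — NOT PRINTED in [Bałaban 1983–89],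
NOT PROVED).  Crux-route work under `Spine/NE7b/`; NOTHING of Bałaban's is asserted; no `def`; zero `sorry`; no `T4Continuum/Support` leaf (FREEZE (0)).
Import (hub olean present): `Literature.….Balaban1983to89.B9SectEKernel` (r1; `ims_lower`, `imsError`).

WHY.  `…AdmissibleFloorIMS.admissible_floor` (this lineage, p378268 ✓) proves the (h2) slot of print's `γ₀` assembly from three displayed letters, one of
which is the IMS Schur letter `ε` in the shape `hrow ∕ hcol : Σ_j |K_F(i,j)| Σ_s (h_s(i) − h_s(j))² ≤ ε` of `B9SectEKernel.ims_lower`.  SectE-interface-proof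
§5.6 values it as `ε_IMS ≤ C_F(d,L)·2^d c_h²(L+1)²∕M²` «(finite-range `≤ L + 1`, coefficients `O_{d,L}(1)`) matrix of `F_V^{full}` … each bond in `≤ 2^d`
supports» and chooses `M ≥ M₃(d,L) := (4C_F2^dc_h²(L+1)²∕c(d,L))^{1∕2}` — p. 428's «Localizing the operators … with `Mα₀` sufficiently small»: the localisation
scale is `M`, the price is `O(M⁻²)`.  THIS FILE makes that valuation a theorem of four elementary sub-letters of `(K_F, h, dist)`, so that after it the
(h2) skeleton displays, for `ε`, only: the range∕coefficient∕neighbour-count of the full form's matrix and the Lipschitz∕multiplicity data of the partition.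

WHAT IS PROVED ([folklore]; `dist : m → m → ℝ` any nonnegative «distance» on the bond index set; `h : ι → m → ℝ` the cutoffs):
* §1 **`sum_sq_diff_le`** — (Lip) `|h_s(i) − h_s(j)| ≤ ℓ·dist(i,j)` and (mult) `#{s : h_s(i) ≠ 0 ∨ h_s(j) ≠ 0} ≤ μ` ⊢ `Σ_s (h_s(i) − h_s(j))² ≤ μ(ℓ·dist(i,j))²`;
  (v1.1) `card_alive_pair_le`, **`mult_pair_of_mult_site`** (per-site multiplicity `μ₀` ⟹ the PAIRWISE letter with `μ = 2μ₀` — chair ι-X-IEL-1).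
* §2 **`ims_row_le`** — + (range) `K(i,j) ≠ 0 → dist(i,j) ≤ R`, (coef) `|K(i,j)| ≤ κ`, (nbhd) `#{j : K(i,j) ≠ 0} ≤ ν`, `0 ≤ ℓ` ⊢
  `Σ_j |K(i,j)| Σ_s (h_s(i) − h_s(j))² ≤ νκμ(ℓR)²` — VERBATIM the `hrow` letter of `ims_lower` ∕ `admissible_floor` with `ε := νκμ(ℓR)²`; **`ims_col_le`** — the
  column letter ((nbhd) for columns; no symmetry of `dist` needed).
* §3 **`eps_le_quarter_of_sq_le`** — `ε(M) = A∕M²` with `A = νκμc_h²R²`: `0 < c`, `0 < M`, `4A∕c ≤ M²` ⊢ `A∕M² ≤ c∕4` (the `M ≥ M₃` bookkeeping of Prop. 5.6),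
  `eps_of_lipschitz_scale` (`ℓ = c_h∕M` ⟹ `νκμ(ℓR)² = (νκμc_h²R²)∕M²`).
* §4 **`ims_lower_of_letters`** — `B9SectEKernel.ims_lower` BY NAME with `hrow ∕ hcol` := §2: `Σ_s ⟨h_s x, K h_s x⟩ − (νκμ(ℓR)²∕2)‖x‖² ≤ ⟨x, Kx⟩`.
* §5 toy: `m = Fin 2`, one cutoff `h ≡ 1` (`ℓ = 0`): the error letter is `0` (`example`).

NOT HERE (honest): the four sub-letters BY VALUE for print's `F_V^{full}` and B6's partition (`R = L + 1`, `κ = C_F(d,L)`, `ν` = bonds within range, `μ = 2^d`,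
`ℓ = c_h∕M` — lattice geometry of [B6] Sect. A's `{h_□}`, not typed here); the other two (h2) letters `δ`, `u_s`; (A3) ∕ (A1c); NC-NE7b-α UNRULED.
BY-NAME EFFECT ON THE WALL: NONE.  NE7b NOT PRINTED ∕ NOT PROVED; spine PROVED 0∕9; rung (B)+1 on ONE finite T⁴ — NOT infinite volume, NOT the mass gap, NOT Clay.
HONEST DEPENDENCY: continuum YM on T⁴ ⇐ BetaPertH ∧ nine spine estimates (0/9 proved); BetaPertH ⇐ (D1) ∧ (D4) ∧ CAP+tail; G-an2-4 gates asym, D1 and NE2/3/4.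
-/

set_option autoImplicit false

noncomputable section

open Matrix Finset
open Literature.MathematicalPhysics.QuantumFieldTheory.Balaban1983to89.B9SectEKernel (ims_lower)

namespace Summit.QuantumFields.BalabanUV.T4Continuum.NE7b.IMSErrorLetters

variable {m ι : Type*} [Fintype m] [Fintype ι]

/-! ## §1 Lipschitz × multiplicity -/

section Partition

omit [Fintype m] in
/-- **`Σ_s (h_s(i) − h_s(j))² ≤ μ(ℓ·dist(i,j))²`** from (Lip) `|h_s(i) − h_s(j)| ≤ ℓ·dist(i,j)` and (mult) at most `μ` cutoffs alive at `i` or `j`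
(the others contribute `0`). [folklore] -/
theorem sum_sq_diff_le (h : ι → m → ℝ) (dist : m → m → ℝ) {ℓ : ℝ} {μ : ℕ}
    (hlip : ∀ s i j, |h s i - h s j| ≤ ℓ * dist i j)
    (hmult : ∀ i j, (Finset.univ.filter fun s => h s i ≠ 0 ∨ h s j ≠ 0).card ≤ μ) (i j : m) :
    ∑ s, (h s i - h s j) ^ 2 ≤ μ * (ℓ * dist i j) ^ 2 := by
  classical
  set F := Finset.univ.filter fun s => h s i ≠ 0 ∨ h s j ≠ 0 with hF
  have hsplit : ∑ s, (h s i - h s j) ^ 2 = ∑ s ∈ F, (h s i - h s j) ^ 2 := by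
    rw [hF, Finset.sum_filter]
    refine Finset.sum_congr rfl fun s _ => ?_
    by_cases hs : h s i ≠ 0 ∨ h s j ≠ 0
    · rw [if_pos hs]
    · rw [if_neg hs]
      obtain ⟨hs1, hs2⟩ := not_or.mp hs
      rw [not_not.mp hs1, not_not.mp hs2, sub_self, zero_pow two_ne_zero]
  rw [hsplit]
  calc ∑ s ∈ F, (h s i - h s j) ^ 2 ≤ ∑ s ∈ F, (ℓ * dist i j) ^ 2 :=
        Finset.sum_le_sum fun s _ => by
          rw [← sq_abs]; exact pow_le_pow_left₀ (abs_nonneg _) (hlip s i j) 2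
    _ = F.card * (ℓ * dist i j) ^ 2 := by rw [Finset.sum_const, nsmul_eq_mul]
    _ ≤ μ * (ℓ * dist i j) ^ 2 := mul_le_mul_of_nonneg_right (by exact_mod_cast hmult i j) (sq_nonneg _)


omit [Fintype m] in
/-- (mult) IS PAIRWISE — and follows from the per-site multiplicity: `#{s : h_s(i) ≠ 0 ∨ h_s(j) ≠ 0} ≤ #{s : h_s(i) ≠ 0} + #{s : h_s(j) ≠ 0}`
(`filter_or` + `card_union_le`). [folklore] -/
theorem card_alive_pair_le (h : ι → m → ℝ) (i j : m) :
    (Finset.univ.filter fun s => h s i ≠ 0 ∨ h s j ≠ 0).card ≤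
      (Finset.univ.filter fun s => h s i ≠ 0).card + (Finset.univ.filter fun s => h s j ≠ 0).card := by
  classical
  rw [Finset.filter_or]
  exact Finset.card_union_le _ _

omit [Fintype m] in
/-- **PER-SITE MULTIPLICITY `μ₀` ⟹ PAIRWISE MULTIPLICITY `2μ₀`**: if every bond meets at most `μ₀` cutoff supports (`2^d` for B6's doubled cubes), then every
PAIR of bonds meets at most `2μ₀` — the `hmult` letter of `sum_sq_diff_le` ∕ `ims_row_le` with `μ := 2μ₀` (the chair's reading ι-X-IEL-1, journal l.57808).
[folklore] -/
theorem mult_pair_of_mult_site (h : ι → m → ℝ) {μ₀ : ℕ}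
    (hsite : ∀ i, (Finset.univ.filter fun s => h s i ≠ 0).card ≤ μ₀) (i j : m) :
    (Finset.univ.filter fun s => h s i ≠ 0 ∨ h s j ≠ 0).card ≤ 2 * μ₀ :=
  (card_alive_pair_le h i j).trans (by have := hsite i; have := hsite j; omega)

end Partition

/-! ## §2 The Schur letters of the IMS error from range, coefficient bound and neighbour count -/

section Schur

/-- **THE ROW LETTER `hrow` OF `ims_lower` ∕ `admissible_floor` FROM SUB-LETTERS**: (Lip), (mult), (range) `K(i,j) ≠ 0 → dist(i,j) ≤ R`, (coef)
`|K(i,j)| ≤ κ`, (nbhd) `#{j : K(i,j) ≠ 0} ≤ ν`, `0 ≤ ℓ`, `0 ≤ dist` ⊢ `Σ_j |K(i,j)|·Σ_s (h_s(i) − h_s(j))² ≤ νκμ(ℓR)²`. [folklore] -/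
theorem ims_row_le (K : Matrix m m ℝ) (h : ι → m → ℝ) (dist : m → m → ℝ) {ℓ κ R : ℝ} {μ ν : ℕ} (hℓ : 0 ≤ ℓ)
    (hdist : ∀ i j, 0 ≤ dist i j) (hlip : ∀ s i j, |h s i - h s j| ≤ ℓ * dist i j)
    (hmult : ∀ i j, (Finset.univ.filter fun s => h s i ≠ 0 ∨ h s j ≠ 0).card ≤ μ)
    (hrange : ∀ i j, K i j ≠ 0 → dist i j ≤ R) (hcoef : ∀ i j, |K i j| ≤ κ)
    (hnb : ∀ i, (Finset.univ.filter fun j => K i j ≠ 0).card ≤ ν) (i : m) :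
    ∑ j, |K i j| * ∑ s, (h s i - h s j) ^ 2 ≤ ν * κ * (μ * (ℓ * R) ^ 2) := by
  classical
  set G := Finset.univ.filter fun j => K i j ≠ 0 with hG
  have hκ : 0 ≤ κ := (abs_nonneg _).trans (hcoef i i)
  -- off the neighbourhood the summand vanishes
  have hsplit : ∑ j, |K i j| * ∑ s, (h s i - h s j) ^ 2 = ∑ j ∈ G, |K i j| * ∑ s, (h s i - h s j) ^ 2 := by
    rw [hG, Finset.sum_filter]
    refine Finset.sum_congr rfl fun j _ => ?_
    by_cases hj : K i j ≠ 0
    · rw [if_pos hj]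
    · rw [if_neg hj]
      rw [not_not.mp hj, abs_zero, zero_mul]
  -- each neighbour costs at most `κ·μ(ℓR)²`
  have hterm : ∀ j ∈ G, |K i j| * ∑ s, (h s i - h s j) ^ 2 ≤ κ * (μ * (ℓ * R) ^ 2) := by
    intro j hj
    have hj' : K i j ≠ 0 := (Finset.mem_filter.1 hj).2
    have hd : ℓ * dist i j ≤ ℓ * R := mul_le_mul_of_nonneg_left (hrange i j hj') hℓ
    have hd0 : 0 ≤ ℓ * dist i j := mul_nonneg hℓ (hdist i j)
    have h1 : ∑ s, (h s i - h s j) ^ 2 ≤ μ * (ℓ * R) ^ 2 :=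
      (sum_sq_diff_le h dist hlip hmult i j).trans
        (mul_le_mul_of_nonneg_left (pow_le_pow_left₀ hd0 hd 2) (Nat.cast_nonneg μ))
    have h0 : 0 ≤ ∑ s, (h s i - h s j) ^ 2 := Finset.sum_nonneg fun s _ => sq_nonneg _
    exact mul_le_mul (hcoef i j) h1 h0 hκ
  rw [hsplit]
  calc ∑ j ∈ G, |K i j| * ∑ s, (h s i - h s j) ^ 2 ≤ ∑ j ∈ G, κ * (μ * (ℓ * R) ^ 2) := Finset.sum_le_sum hterm
    _ = G.card * (κ * (μ * (ℓ * R) ^ 2)) := by rw [Finset.sum_const, nsmul_eq_mul]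
    _ ≤ ν * (κ * (μ * (ℓ * R) ^ 2)) :=
        mul_le_mul_of_nonneg_right (by exact_mod_cast hnb i) (by positivity)
    _ = ν * κ * (μ * (ℓ * R) ^ 2) := by ring

/-- **THE COLUMN LETTER `hcol`**: the same bound for `Σ_i |K(i,j)|·Σ_s (h_s(i) − h_s(j))²` with (nbhd) for columns `#{i : K(i,j) ≠ 0} ≤ ν` (no symmetry of
`dist` needed: (range) is asked at every nonzero entry). [folklore] -/
theorem ims_col_le (K : Matrix m m ℝ) (h : ι → m → ℝ) (dist : m → m → ℝ) {ℓ κ R : ℝ} {μ ν : ℕ} (hℓ : 0 ≤ ℓ)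
    (hdist : ∀ i j, 0 ≤ dist i j) (hlip : ∀ s i j, |h s i - h s j| ≤ ℓ * dist i j)
    (hmult : ∀ i j, (Finset.univ.filter fun s => h s i ≠ 0 ∨ h s j ≠ 0).card ≤ μ)
    (hrange : ∀ i j, K i j ≠ 0 → dist i j ≤ R) (hcoef : ∀ i j, |K i j| ≤ κ)
    (hnbc : ∀ j, (Finset.univ.filter fun i => K i j ≠ 0).card ≤ ν) (j : m) :
    ∑ i, |K i j| * ∑ s, (h s i - h s j) ^ 2 ≤ ν * κ * (μ * (ℓ * R) ^ 2) := by
  classical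
  set G := Finset.univ.filter fun i => K i j ≠ 0 with hG
  have hκ : 0 ≤ κ := (abs_nonneg _).trans (hcoef j j)
  have hsplit : ∑ i, |K i j| * ∑ s, (h s i - h s j) ^ 2 = ∑ i ∈ G, |K i j| * ∑ s, (h s i - h s j) ^ 2 := by
    rw [hG, Finset.sum_filter]
    refine Finset.sum_congr rfl fun i _ => ?_
    by_cases hi : K i j ≠ 0
    · rw [if_pos hi]
    · rw [if_neg hi]
      rw [not_not.mp hi, abs_zero, zero_mul]
  have hterm : ∀ i ∈ G, |K i j| * ∑ s, (h s i - h s j) ^ 2 ≤ κ * (μ * (ℓ * R) ^ 2) := by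
    intro i hi
    have hi' : K i j ≠ 0 := (Finset.mem_filter.1 hi).2
    have hd : ℓ * dist i j ≤ ℓ * R := mul_le_mul_of_nonneg_left (hrange i j hi') hℓ
    have hd0 : 0 ≤ ℓ * dist i j := mul_nonneg hℓ (hdist i j)
    have h1 : ∑ s, (h s i - h s j) ^ 2 ≤ μ * (ℓ * R) ^ 2 :=
      (sum_sq_diff_le h dist hlip hmult i j).trans
        (mul_le_mul_of_nonneg_left (pow_le_pow_left₀ hd0 hd 2) (Nat.cast_nonneg μ))
    have h0 : 0 ≤ ∑ s, (h s i - h s j) ^ 2 := Finset.sum_nonneg fun s _ => sq_nonneg _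
    exact mul_le_mul (hcoef i j) h1 h0 hκ
  rw [hsplit]
  calc ∑ i ∈ G, |K i j| * ∑ s, (h s i - h s j) ^ 2 ≤ ∑ i ∈ G, κ * (μ * (ℓ * R) ^ 2) := Finset.sum_le_sum hterm
    _ = G.card * (κ * (μ * (ℓ * R) ^ 2)) := by rw [Finset.sum_const, nsmul_eq_mul]
    _ ≤ ν * (κ * (μ * (ℓ * R) ^ 2)) :=
        mul_le_mul_of_nonneg_right (by exact_mod_cast hnbc j) (by positivity)
    _ = ν * κ * (μ * (ℓ * R) ^ 2) := by ring

end Schur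

/-! ## §3 The `M`-bookkeeping: `ℓ = c_h∕M`, `ε(M) = A∕M² ≤ c∕4` for `M² ≥ 4A∕c` -/

section Scale

/-- `ℓ = c_h∕M` ⟹ `νκμ(ℓR)² = (νκμc_h²R²)∕M²`. [folklore] -/
theorem eps_of_lipschitz_scale {ν κ μ ch R M : ℝ} (hM : M ≠ 0) :
    ν * κ * (μ * (ch / M * R) ^ 2) = ν * κ * μ * ch ^ 2 * R ^ 2 / M ^ 2 := by
  field_simp

/-- **`M ≥ M₃` ⟹ `ε ≤ c∕4`**: `0 < c`, `0 < M`, `4A∕c ≤ M²` ⊢ `A∕M² ≤ c∕4` (SectE-interface-proof Prop. 5.6: `M₃ := (4C_F2^dc_h²(L+1)²∕c)^{1∕2}`). [folklore] -/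
theorem eps_le_quarter_of_sq_le {A c M : ℝ} (hc : 0 < c) (hM : 0 < M) (hAM : 4 * A / c ≤ M ^ 2) :
    A / M ^ 2 ≤ c / 4 := by
  have hM2 : 0 < M ^ 2 := by positivity
  rw [div_le_div_iff₀ hM2 (by norm_num : (0 : ℝ) < 4)]
  rw [div_le_iff₀ hc] at hAM
  linarith

end Scale

/-! ## §4 `ims_lower` BY NAME with its Schur letters supplied -/

section Junction

/-- **IMS WITH THE ERROR LETTER FROM SUB-LETTERS** (`B9SectEKernel.ims_lower` BY NAME, `hrow ∕ hcol` := §2): for ANY matrix `K`, a quadratic partition of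
unity `Σ_s h_s(i)² = 1` with (Lip)∕(mult), and (range)∕(coef)∕(nbhd rows and columns) for `K` w.r.t. a nonnegative `dist`:
`Σ_s ⟨h_s x, K h_s x⟩ − (νκμ(ℓR)²∕2)‖x‖² ≤ ⟨x, Kx⟩`. [folklore] -/
theorem ims_lower_of_letters (K : Matrix m m ℝ) (h : ι → m → ℝ) (hpart : ∀ i, ∑ s, h s i ^ 2 = 1)
    (dist : m → m → ℝ) {ℓ κ R : ℝ} {μ ν : ℕ} (hℓ : 0 ≤ ℓ)
    (hdist : ∀ i j, 0 ≤ dist i j) (hlip : ∀ s i j, |h s i - h s j| ≤ ℓ * dist i j)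
    (hmult : ∀ i j, (Finset.univ.filter fun s => h s i ≠ 0 ∨ h s j ≠ 0).card ≤ μ)
    (hrange : ∀ i j, K i j ≠ 0 → dist i j ≤ R) (hcoef : ∀ i j, |K i j| ≤ κ)
    (hnb : ∀ i, (Finset.univ.filter fun j => K i j ≠ 0).card ≤ ν)
    (hnbc : ∀ j, (Finset.univ.filter fun i => K i j ≠ 0).card ≤ ν) (x : m → ℝ) :
    ∑ s, (h s * x) ⬝ᵥ (K *ᵥ (h s * x)) - ν * κ * (μ * (ℓ * R) ^ 2) / 2 * (x ⬝ᵥ x) ≤ x ⬝ᵥ (K *ᵥ x) := by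
  rcases isEmpty_or_nonempty m with hm | ⟨⟨i₀⟩⟩
  · -- over an empty index set every dot product vanishes
    simp [dotProduct]
  · have hκ : 0 ≤ κ := (abs_nonneg _).trans (hcoef i₀ i₀)
    have hε : 0 ≤ (ν : ℝ) * κ * (μ * (ℓ * R) ^ 2) := by positivity
    exact ims_lower K h hpart hε (ims_row_le K h dist hℓ hdist hlip hmult hrange hcoef hnb)
      (ims_col_le K h dist hℓ hdist hlip hmult hrange hcoef hnbc) x

end Junction

/-! ## §5 Toy: one cutoff `h ≡ 1` — Lipschitz constant `0`, the error letter vanishes -/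

section Toy

/- `m = Fin 2`, `ι = Unit`, `h ≡ 1`, `dist ≡ 0`, `ℓ = 0`: §1 gives `Σ_s (1 − 1)² ≤ 1·(0·0)²`. -/
example (i j : Fin 2) : ∑ _s : Unit, ((1 : ℝ) - 1) ^ 2 ≤ (1 : ℕ) * ((0 : ℝ) * 0) ^ 2 :=
  sum_sq_diff_le (ι := Unit) (fun _ _ => (1 : ℝ)) (fun _ _ => (0 : ℝ)) (ℓ := 0) (μ := 1)
    (fun _ _ _ => by simp) (fun _ _ => by simp) i j

end Toy

end Summit.QuantumFields.BalabanUV.T4Continuum.NE7b.IMSErrorLetters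

end
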